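import Literature.Topology.FourManifolds.SphereHypersurfaceSides
import Literature.Topology.FourManifolds.ClosedBallExtension
import Literature.Topology.FourManifolds.ClosedBallTangent
import Literature.Topology.FourManifolds.ImmersionOrientation
import Literature.Topology.FourManifolds.InverseFunctionTheorem
import Literature.Topology.FourManifolds.FramedTubularNbhd
import Literature.Topology.FourManifolds.HCobordismIdealCircleProofs
import Literature.Topology.FourManifolds.CorkDecomposition
import Literature.Topology.FourManifolds.SchoenfliesBallForm
import Literature.Topology.FourManifolds.SchoenfliesSphereThree
import Mathlib.Analysis.InnerProductSpace.Calculus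
import HarnessLib


/-!
# A closed side which is a smooth ball is a smoothly embedded ball; the residual content of
# Alexander's theorem

Topic `Literature/Topology/FourManifolds` (fact seat of the Schoenflies theorem in `S³`,
`SphereEmbedding.schoenflies_exists_ball` / `…_ambientIsotopy_image_eq_sphereEquator`,
`SchoenfliesSphereThree.lean`; Schultens, *Introduction to 3-Manifolds* (2014), Thm. 3.2.5 with
Cor. 3.2.6).  **Everything in this file is proved; no named fact is introduced.**  Third brick
after `SphereHypersurfaceSides.lean` (the closed sides `W = {g ≤ 0}`, `W' = {g ≥ 0}` of a smooth
hypersurface sphere as compact contractible smooth manifolds with boundary) and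
`SchoenfliesSphereTwo.lean` (both sides balls ⇒ standard, two-sided; the 2-dimensional theorem
from the cancellation leaves).

The named fact renders "the 2-sphere `S` bounds a 3-ball" *extrinsically*: a smooth embedding
`e : ℝ³ → S³` of all of Euclidean space with `e(∂𝔻³) = S` (and the closed ball missing a given
point `p`).  Any intrinsic proof — Alexander's / Casson's induction on saddles (Schultens
pp. 43–45), which cuts and pastes the *regions* bounded by spheres — ends instead with a
diffeomorphism `W ≅ 𝔻³` of the closed side as a manifold with boundary.  This file supplies the
adapter, in every dimension and from ONE side only:

* §1 `ClosedDiscExtension.exists_injOn_thickening`: a continuous map injective on a compact set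
  `K` and locally injective at its points is injective on a thickening of `K` (Hirsch, Ch. 2 §1,
  Exercise 7);
* §2 `ClosedDiscExtension.squeeze R` — Mathlib's `univBall 0 R`, the radial diffeomorphism
  `x ↦ R x / √(1 + ‖x‖²)` of a real inner product space onto `B(0, R)`: norm formula, images of
  spheres and closed balls (`image_squeeze_sphere/closedBall`), local diffeomorphism;
* §3 `ClosedDiscExtension.exists_isSmoothEmbedding_extension` (**extension of a closed-disc
  embedding**): a smooth embedding `j : 𝔻ⁿ⁺¹ → E'` of the closed disc (manifold with boundary,
  `ClosedBall.lean`) into a real normed space of dimension `n + 1` yields a smooth embedding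
  `e : ℝⁿ⁺¹ → E'` with `e(𝕊ⁿ) = j(∂𝔻ⁿ⁺¹)`, `e(𝔻ⁿ⁺¹) = j(𝔻ⁿ⁺¹)`, `e(B̊ⁿ⁺¹) = j(int 𝔻ⁿ⁺¹)`:
  extend `j` to a smooth `G` (Seeley, `exists_contDiff_extension_of_contMDiff_closedBall`,
  `ClosedBallExtension.lean`); `DG` is invertible on the disc (`mfderiv_comp_coe_closedBall`,
  `ClosedBallTangent.lean`, with `injective_mfderiv_of_isImmersionAt'`), hence on a ball
  `B(0, 1 + ε₁)` (invertibility is open); `G` is injective on the disc and locally injective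
  there (inverse function theorem), hence injective on `B(0, 1 + δ)` (§1); precompose with the
  squeeze onto `B(0, R)`, `R = 1 + min ε₁ δ`, rescaled by `s = 1/√(R² − 1)` so that the unit
  sphere goes to the unit sphere; an injective local diffeomorphism is a smooth embedding
  (`isSmoothEmbedding_of_isLocalDiffeomorph`, `FramedTubularNbhd.lean`);
* §4 `IsSidePackage.exists_ball_of_diffeomorph_regularSublevel` (**main theorem**): if the closed
  side `W = {g ≤ 0}` of a side package of `Z ⊆ 𝕊 (m+1)` is diffeomorphic to `𝔻ᵐ⁺¹` then for
  every `p` with `g p > 0` there is a smooth embedding `e : ℝᵐ⁺¹ → 𝕊 (m+1)` with `e(𝕊ᵐ) = Z`,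
  `e(𝔻ᵐ⁺¹) = W` and `p ∉ range e` (read `ι_W ∘ Ψ⁻¹` in the stereographic chart from `p`, §3,
  and back; the boundary sphere goes to `Z` by invariance of the boundary,
  `image_incl_symm_norm_eq_one`); bundled form
  `SphereEmbedding.exists_ball_of_diffeomorph_regularSublevel`;
* §5 `SphereEmbedding.schoenflies_exists_ball_of_sides_diffeomorph_closedBall` (**the residual
  content of Alexander's theorem**): the named fact `SphereEmbedding.schoenflies_exists_ball`
  follows from "for every `S : SphereEmbedding 2 3` and every side package `g` of `range S`,
  `{g ≤ 0} ≅ 𝔻³`" — an intrinsic statement about the compact region bounded by the sphere, the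
  form in which the saddle induction delivers it.

## References

* J. Schultens, *Introduction to 3-Manifolds*, GSM 151, AMS (2014), Thm. 3.2.5 and Cor. 3.2.6
  (PDF pp. 43–45 of the held copy `book:schultens2014-introduction-3-manifolds`). [Schultens2014]
* M. W. Hirsch, *Differential Topology*, GTM 33 (1976), Ch. 2 §1, Exercise 7 (an immersion
  injective on a compact set is injective on a neighbourhood); Ch. 1 §3. [HirschDT1976]
* J. M. Lee, *Introduction to Smooth Manifolds*, 2nd ed. (2013), Lemma 2.26, Thm. 4.5 (inverse
  function theorem for manifolds), Prop. 4.8, 5.2. [LeeSmoothManifolds2013]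

## Design notes

* One side suffices and no extension of the seam diffeomorphism over the ball is needed (contrast
  `SchoenfliesSphereTwo.lean`, §3): this is the route to the 3-dimensional fact, where Smale's
  theorem on `Diff(S²)` is not available in the tree.
* The extension `e` of §3 is NOT claimed to agree with `j` on the disc (the squeeze reparametrises
  radially); only the three images are recorded, which is all the ball form consumes.
-/

open scoped Manifold ContDiff Topology Pointwise
open Set Function Metric Module Filter

noncomputable section

namespace Literature.Topology.FourManifolds

universe u

/-- Local notation: `𝔼 n` is the model Euclidean space `EuclideanSpace ℝ (Fin n)`. -/
local notation "𝔼 " n:arg => EuclideanSpace ℝ (Fin n)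

/-- Local notation: `𝕊 n` is the unit sphere in `EuclideanSpace ℝ (Fin (n + 1))`. -/
local notation "𝕊 " n:arg => (Metric.sphere (0 : EuclideanSpace ℝ (Fin (n + 1))) 1)

/-- Local notation: `𝔻 n` is the closed unit ball in `EuclideanSpace ℝ (Fin n)`. -/
local notation "𝔻 " n:arg => (Metric.closedBall (0 : EuclideanSpace ℝ (Fin n)) 1)

namespace ClosedDiscExtension

/-! ### §1 Injectivity near a compact set -/

/-- **A continuous map which is injective on a compact set `K` and locally injective at each
point of `K` is injective on a uniform neighbourhood of `K`** (Hirsch, *Differential Topology*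
(1976), Ch. 2 §1, Exercise 7, for compact `K`; the point-set step of the tubular neighbourhood
construction, cf. `exists_injOn_prod_ball`). Proof: the compact `K × K` is covered by the open set of
pairs `(x, y)` which are either both in a set of injectivity or have `G x ≠ G y`; a thickening of
`K × K` stays inside. [cite: HirschDT1976, Ch. 2 §1 Exercise 7] -/
theorem exists_injOn_thickening {X Y : Type*} [PseudoMetricSpace X] [TopologicalSpace Y]
    [T2Space Y] {K : Set X} (hK : IsCompact K) {G : X → Y} (hG : Continuous G)
    (hinj : InjOn G K) (hloc : ∀ x ∈ K, ∃ U ∈ 𝓝 x, InjOn G U) :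
    ∃ δ : ℝ, 0 < δ ∧ InjOn G (thickening δ K) := by
  classical
  -- the good open set of pairs
  choose! U hU hUinj using hloc
  set O : Set (X × X) :=
    (⋃ x ∈ K, interior (U x) ×ˢ interior (U x)) ∪ {q | G q.1 ≠ G q.2} with hO
  have hOopen : IsOpen O := by
    refine (isOpen_biUnion fun x _ => isOpen_interior.prod isOpen_interior).union ?_
    exact isOpen_ne_fun (hG.comp continuous_fst) (hG.comp continuous_snd)
  have hKO : K ×ˢ K ⊆ O := by
    rintro ⟨x, y⟩ hmem
    obtain ⟨hx, hy⟩ : x ∈ K ∧ y ∈ K := hmem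
    by_cases hxy : G x = G y
    · have hxy' : x = y := hinj hx hy hxy
      subst hxy'
      refine Or.inl (mem_iUnion₂.2 ⟨x, hx, ?_⟩)
      exact ⟨mem_interior_iff_mem_nhds.2 (hU x hx), mem_interior_iff_mem_nhds.2 (hU x hx)⟩
    · exact Or.inr hxy
  have hgood : ∀ q ∈ O, G q.1 = G q.2 → q.1 = q.2 := by
    rintro ⟨x, y⟩ hq hxy
    rcases hq with hq | hq
    · obtain ⟨a, ha, hq⟩ := mem_iUnion₂.1 hq
      exact hUinj a ha (interior_subset hq.1) (interior_subset hq.2) hxy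
    · exact (hq hxy).elim
  obtain ⟨δ, hδ, hsub⟩ := (hK.prod hK).exists_thickening_subset_open hOopen hKO
  refine ⟨δ, hδ, fun x hx y hy hxy => ?_⟩
  have hmem : (x, y) ∈ thickening δ (K ×ˢ K) := by
    rw [mem_thickening_iff] at hx hy ⊢
    obtain ⟨a, ha, hxa⟩ := hx
    obtain ⟨b, hb, hyb⟩ := hy
    exact ⟨(a, b), ⟨ha, hb⟩, by rw [Prod.dist_eq]; exact max_lt hxa hyb⟩
  exact hgood (x, y) (hsub hmem) hxy

/-! ### §2 The radial squeeze of `ℝⁿ` onto a ball -/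

section Squeeze

variable {F : Type*} [NormedAddCommGroup F] [InnerProductSpace ℝ F]

/-- The norm of `univUnitBall x = x / √(1 + ‖x‖²)`. [folklore] -/
theorem norm_univUnitBall (x : F) :
    ‖OpenPartialHomeomorph.univUnitBall x‖ = ‖x‖ / Real.sqrt (1 + ‖x‖ ^ 2) := by
  rw [OpenPartialHomeomorph.univUnitBall_apply, norm_smul, norm_inv, Real.norm_eq_abs,
    abs_of_pos (Real.sqrt_pos.2 (by positivity)), div_eq_inv_mul]

/-- The radial profile `t ↦ t / √(1 + t²)` is strictly increasing on `[0, ∞)` (indeed injective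
on `[0, ∞)`). [folklore] -/
theorem div_sqrt_one_add_sq_injOn :
    InjOn (fun t : ℝ => t / Real.sqrt (1 + t ^ 2)) (Ici 0) := by
  intro a ha b hb hab
  have ha' : (0 : ℝ) ≤ a := ha
  have hb' : (0 : ℝ) ≤ b := hb
  have h1 : 0 < Real.sqrt (1 + a ^ 2) := Real.sqrt_pos.2 (by positivity)
  have h2 : 0 < Real.sqrt (1 + b ^ 2) := Real.sqrt_pos.2 (by positivity)
  have hab' : a / Real.sqrt (1 + a ^ 2) = b / Real.sqrt (1 + b ^ 2) := hab
  rw [div_eq_div_iff h1.ne' h2.ne'] at hab'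
  have hsq := congrArg (fun t => t ^ 2) hab'
  simp only [mul_pow, Real.sq_sqrt (by positivity : (0 : ℝ) ≤ 1 + b ^ 2),
    Real.sq_sqrt (by positivity : (0 : ℝ) ≤ 1 + a ^ 2)] at hsq
  have hab2 : a ^ 2 = b ^ 2 := by nlinarith
  exact (sq_eq_sq₀ ha' hb').1 hab2

variable {R : ℝ}

/-- **The squeeze** `h_R x = R · x / √(1 + ‖x‖²)` of `F` onto the open ball `B(0, R)` (Mathlib's
`OpenPartialHomeomorph.univBall 0 R` as a function). [folklore] -/
def squeeze (R : ℝ) : F → F := OpenPartialHomeomorph.univBall (0 : F) R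

/-- The squeeze is `x ↦ R x / √(1 + ‖x‖²)`. [folklore] -/
theorem squeeze_eq_smul (hR : 0 < R) (x : F) :
    squeeze R x = R • OpenPartialHomeomorph.univUnitBall x := by
  simp [squeeze, OpenPartialHomeomorph.univBall, dif_pos hR,
    OpenPartialHomeomorph.unitBallBall_apply]

/-- The norm of the squeeze: `‖h_R x‖ = R ‖x‖ / √(1 + ‖x‖²)`. [folklore] -/
theorem norm_squeeze (hR : 0 < R) (x : F) :
    ‖squeeze R x‖ = R * (‖x‖ / Real.sqrt (1 + ‖x‖ ^ 2)) := by
  rw [squeeze_eq_smul hR, norm_smul, Real.norm_eq_abs, abs_of_pos hR, norm_univUnitBall]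

/-- The squeeze is smooth. [folklore] -/
theorem contDiff_squeeze (R : ℝ) : ContDiff ℝ ∞ (squeeze (F := F) R) :=
  OpenPartialHomeomorph.contDiff_univBall

/-- The squeeze is injective. [folklore] -/
theorem injective_squeeze (R : ℝ) : Injective (squeeze (F := F) R) :=
  univBall_injective R

/-- The squeeze maps onto the open ball `B(0, R)`. [folklore] -/
theorem range_squeeze (hR : 0 < R) : range (squeeze (F := F) R) = ball 0 R := by
  rw [squeeze, ← OpenPartialHomeomorph.univBall_target (0 : F) hR,
    ← OpenPartialHomeomorph.image_source_eq_target, OpenPartialHomeomorph.univBall_source,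
    image_univ]

/-- The squeeze as a partial diffeomorphism `F ≃ B(0, R)`. [folklore] -/
def squeezePartialDiffeomorph (hR : 0 < R) : PartialDiffeomorph 𝓘(ℝ, F) 𝓘(ℝ, F) F F ∞ where
  toPartialEquiv := (OpenPartialHomeomorph.univBall (0 : F) R).toPartialEquiv
  open_source := (OpenPartialHomeomorph.univBall (0 : F) R).open_source
  open_target := (OpenPartialHomeomorph.univBall (0 : F) R).open_target
  contMDiffOn_toFun := (OpenPartialHomeomorph.contDiff_univBall (c := (0 : F)) (r := R)
    (n := ⊤)).contMDiff.contMDiffOn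
  contMDiffOn_invFun := by
    change ContMDiffOn 𝓘(ℝ, F) 𝓘(ℝ, F) ∞ (OpenPartialHomeomorph.univBall (0 : F) R).symm
      (OpenPartialHomeomorph.univBall (0 : F) R).target
    rw [OpenPartialHomeomorph.univBall_target (0 : F) hR]
    exact OpenPartialHomeomorph.contDiffOn_univBall_symm.contMDiffOn

/-- The squeeze is a local diffeomorphism at every point. [folklore] -/
theorem isLocalDiffeomorph_squeeze (hR : 0 < R) :
    IsLocalDiffeomorph 𝓘(ℝ, F) 𝓘(ℝ, F) ∞ (squeeze (F := F) R) := fun x =>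
  PartialDiffeomorph.isLocalDiffeomorphAt 𝓘(ℝ, F) 𝓘(ℝ, F) ∞ (squeezePartialDiffeomorph hR)
    (by
      change x ∈ (OpenPartialHomeomorph.univBall (0 : F) R).source
      rw [OpenPartialHomeomorph.univBall_source]; exact mem_univ x)

/-- The squeeze maps the sphere of radius `s` onto the sphere of radius `R s / √(1 + s²)`. [folklore] -/
theorem image_squeeze_sphere (hR : 0 < R) {s : ℝ} (hs : 0 ≤ s) :
    squeeze R '' sphere (0 : F) s = sphere 0 (R * (s / Real.sqrt (1 + s ^ 2))) := by
  apply subset_antisymm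
  · rintro _ ⟨x, hx, rfl⟩
    rw [mem_sphere_zero_iff_norm] at hx ⊢
    rw [norm_squeeze hR, hx]
  · intro y hy
    rw [mem_sphere_zero_iff_norm] at hy
    have hlt : R * (s / Real.sqrt (1 + s ^ 2)) < R := by
      have : s / Real.sqrt (1 + s ^ 2) < 1 := by
        rw [div_lt_one (Real.sqrt_pos.2 (by positivity))]
        calc s = Real.sqrt (s ^ 2) := (Real.sqrt_sq hs).symm
          _ < Real.sqrt (1 + s ^ 2) := Real.sqrt_lt_sqrt (sq_nonneg _) (by linarith)
      nlinarith
    have hyR : y ∈ ball (0 : F) R := by rw [mem_ball_zero_iff, hy]; exact hlt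
    rw [← range_squeeze hR] at hyR
    obtain ⟨x, rfl⟩ := hyR
    refine ⟨x, ?_, rfl⟩
    rw [mem_sphere_zero_iff_norm]
    rw [norm_squeeze hR] at hy
    have h' : ‖x‖ / Real.sqrt (1 + ‖x‖ ^ 2) = s / Real.sqrt (1 + s ^ 2) :=
      mul_left_cancel₀ hR.ne' hy
    exact div_sqrt_one_add_sq_injOn (norm_nonneg x) hs h'

/-- The squeeze maps the closed ball of radius `s` onto the closed ball of radius
`R s / √(1 + s²)`. [folklore] -/
theorem image_squeeze_closedBall (hR : 0 < R) {s : ℝ} (hs : 0 ≤ s) :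
    squeeze R '' closedBall (0 : F) s = closedBall 0 (R * (s / Real.sqrt (1 + s ^ 2))) := by
  apply subset_antisymm
  · rintro _ ⟨x, hx, rfl⟩
    rw [mem_closedBall_zero_iff] at hx ⊢
    obtain ⟨r, hr0, hrs, hxr⟩ : ∃ r, 0 ≤ r ∧ r ≤ s ∧ ‖x‖ = r := ⟨‖x‖, norm_nonneg _, hx, rfl⟩
    have h1 : squeeze R x ∈ sphere (0 : F) (R * (r / Real.sqrt (1 + r ^ 2))) := by
      rw [← image_squeeze_sphere hR hr0]; exact ⟨x, mem_sphere_zero_iff_norm.2 hxr, rfl⟩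
    rw [mem_sphere_zero_iff_norm] at h1
    rw [h1]
    refine mul_le_mul_of_nonneg_left ?_ hR.le
    -- monotonicity of `t ↦ t / √(1 + t²)`
    rw [div_le_div_iff₀ (Real.sqrt_pos.2 (by positivity)) (Real.sqrt_pos.2 (by positivity))]
    have h3 : r * Real.sqrt (1 + s ^ 2) ≤ s * Real.sqrt (1 + r ^ 2) := by
      rw [← Real.sqrt_sq hr0, ← Real.sqrt_sq hs, ← Real.sqrt_mul (sq_nonneg _),
        ← Real.sqrt_mul (sq_nonneg _), Real.sqrt_sq hr0, Real.sqrt_sq hs]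
      apply Real.sqrt_le_sqrt
      nlinarith [mul_le_mul hrs hrs hr0 hs]
    exact h3
  · intro y hy
    rw [mem_closedBall_zero_iff] at hy
    obtain ⟨r, hr0, hrs, hyr⟩ : ∃ r, 0 ≤ r ∧ r ≤ R * (s / Real.sqrt (1 + s ^ 2)) ∧ ‖y‖ = r :=
      ⟨‖y‖, norm_nonneg _, hy, rfl⟩
    -- `r = R t/√(1+t²)` for some `t ∈ [0, s]`
    have hlt1 : s / Real.sqrt (1 + s ^ 2) < 1 := by
      rw [div_lt_one (Real.sqrt_pos.2 (by positivity))]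
      calc s = Real.sqrt (s ^ 2) := (Real.sqrt_sq hs).symm
        _ < Real.sqrt (1 + s ^ 2) := Real.sqrt_lt_sqrt (sq_nonneg _) (by linarith)
    have hrR : r / R < 1 := by
      rw [div_lt_one hR]; nlinarith
    have hrR0 : 0 ≤ r / R := div_nonneg hr0 hR.le
    -- invert the profile: `t = u / √(1 - u²)` with `u = r / R`
    set u := r / R with hu
    set t := u / Real.sqrt (1 - u ^ 2) with ht
    have hu1 : 0 < 1 - u ^ 2 := by nlinarith
    have ht0 : 0 ≤ t := div_nonneg hrR0 (Real.sqrt_nonneg _)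
    have hprof : t / Real.sqrt (1 + t ^ 2) = u := by
      have hs1 : Real.sqrt (1 - u ^ 2) ≠ 0 := (Real.sqrt_pos.2 hu1).ne'
      have h1t : 1 + t ^ 2 = 1 / (1 - u ^ 2) := by
        rw [ht, div_pow, Real.sq_sqrt hu1.le]
        field_simp
        ring
      rw [h1t, Real.sqrt_div' _ hu1.le, Real.sqrt_one, ht]
      rw [div_div_eq_mul_div]
      field_simp
    have hts : t ≤ s := by
      -- from `u ≤ s/√(1+s²)` and monotonicity
      refine le_of_not_gt fun hlt => ?_
      have hmono : s / Real.sqrt (1 + s ^ 2) < t / Real.sqrt (1 + t ^ 2) := by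
        rw [div_lt_div_iff₀ (Real.sqrt_pos.2 (by positivity)) (Real.sqrt_pos.2 (by positivity))]
        rw [← Real.sqrt_sq hs, ← Real.sqrt_sq ht0, ← Real.sqrt_mul (sq_nonneg _),
          ← Real.sqrt_mul (sq_nonneg _), Real.sqrt_sq hs, Real.sqrt_sq ht0]
        apply Real.sqrt_lt_sqrt (by positivity)
        nlinarith [mul_lt_mul'' hlt hlt hs hs]
      rw [hprof, hu] at hmono
      rw [lt_div_iff₀ hR] at hmono
      nlinarith
    have hyball : y ∈ ball (0 : F) R := by
      rw [mem_ball_zero_iff, hyr]; nlinarith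
    rw [← range_squeeze hR] at hyball
    obtain ⟨x, rfl⟩ := hyball
    refine ⟨x, ?_, rfl⟩
    rw [mem_closedBall_zero_iff]
    rw [norm_squeeze hR] at hyr
    have hx' : ‖x‖ / Real.sqrt (1 + ‖x‖ ^ 2) = t / Real.sqrt (1 + t ^ 2) := by
      rw [hprof, hu, eq_div_iff hR.ne', mul_comm]; exact hyr
    have := div_sqrt_one_add_sq_injOn (norm_nonneg x) ht0 hx'
    rw [this]; exact hts

end Squeeze

/-! ### §3 Extending a closed-disc embedding to an open ball -/

section Extension

variable {n : ℕ} {E' : Type*} [NormedAddCommGroup E'] [NormedSpace ℝ E'] [FiniteDimensional ℝ E']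

/-- An injective continuous linear map between spaces of the same finite dimension is (the
coercion of) a continuous linear equivalence. [folklore] -/
theorem exists_continuousLinearEquiv_coe_eq {A : 𝔼 (n + 1) →L[ℝ] E'} (hA : Injective A)
    (hdim : finrank ℝ E' = n + 1) :
    ∃ L : 𝔼 (n + 1) ≃L[ℝ] E', (L : 𝔼 (n + 1) →L[ℝ] E') = A := by
  refine ⟨(LinearMap.linearEquivOfInjective (A : 𝔼 (n + 1) →ₗ[ℝ] E') hA
    (by rw [hdim, finrank_euclideanSpace_fin])).toContinuousLinearEquiv, ?_⟩
  ext v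
  simp

/-- **The Seeley extension of a closed-disc immersion has invertible derivative on the disc.**
If `G : ℝⁿ⁺¹ → E'` is `C¹` and restricts on `𝔻ⁿ⁺¹` to an immersion of the disc (as a manifold
with boundary) into `E'`, `dim E' = n + 1`, then `DG(x)` is invertible at every point of the
closed disc (`mfderiv (G|𝔻) x = DG(x) ∘ closedBallCoeDeriv x`, `ClosedBallTangent.lean`, and the
differential of an immersion is injective, `injective_mfderiv_of_isImmersionAt'`). [folklore] -/
theorem exists_coe_eq_fderiv_of_isImmersion (hdim : finrank ℝ E' = n + 1) {G : 𝔼 (n + 1) → E'}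
    (hG : ContDiff ℝ ∞ G)
    (himm : Manifold.IsImmersion (𝓡∂ (n + 1)) 𝓘(ℝ, E') ∞ fun y : 𝔻 (n + 1) => G y)
    (x : 𝔻 (n + 1)) :
    ∃ L : 𝔼 (n + 1) ≃L[ℝ] E', (L : 𝔼 (n + 1) →L[ℝ] E') = fderiv ℝ G (x : 𝔼 (n + 1)) := by
  have hdiff : DifferentiableAt ℝ G (x : 𝔼 (n + 1)) := (hG.differentiable (by simp)).differentiableAt
  have h1 := mfderiv_comp_coe_closedBall (g := G) x hdiff
  have hinj : Injective (mfderiv (𝓡∂ (n + 1)) 𝓘(ℝ, E') (fun y : 𝔻 (n + 1) => G y) x) :=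
    injective_mfderiv_of_isImmersionAt' (himm.isImmersionAt x)
  rw [h1] at hinj
  have hinj' : Injective (fderiv ℝ G (x : 𝔼 (n + 1))) :=
    Injective.of_comp_right hinj (closedBallCoeDeriv x).surjective
  exact exists_continuousLinearEquiv_coe_eq hinj' hdim

/-- **Extension of a closed-disc embedding.** Let `j : 𝔻ⁿ⁺¹ → E'` be a smooth embedding of the
closed disc (manifold with boundary) into a real normed space of dimension `n + 1`. Then there is
a smooth embedding `e : ℝⁿ⁺¹ → E'` (onto an open set) with `e(𝕊ⁿ) = j(∂𝔻ⁿ⁺¹)`,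
`e(𝔻ⁿ⁺¹) = j(𝔻ⁿ⁺¹)` and `e(B̊ⁿ⁺¹) = j(int 𝔻ⁿ⁺¹)`.  Proof: extend `j` to a smooth `G` on `ℝⁿ⁺¹`
(Seeley, `exists_contDiff_extension_of_contMDiff_closedBall`); `DG` is invertible on the disc,
hence on a ball `B(0, 1 + ε₁)`; `G` is injective on the disc and locally injective there (inverse
function theorem), hence injective on a ball `B(0, 1 + δ)` (`exists_injOn_thickening`); precompose
`G` with the squeeze of `ℝⁿ⁺¹` onto `B(0, R)`, `R = 1 + min ε₁ δ`, rescaled so that the unit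
sphere goes to the unit sphere. (Hirsch, Ch. 2 §1 Exercise 7 with Ch. 1 §3; a stand-in for the
collar-matching argument.) [folklore] -/
theorem exists_isSmoothEmbedding_extension (hdim : finrank ℝ E' = n + 1) {j : (𝔻 (n + 1)) → E'}
    (hj : Manifold.IsSmoothEmbedding (𝓡∂ (n + 1)) 𝓘(ℝ, E') ∞ j) :
    ∃ e : 𝔼 (n + 1) → E', Manifold.IsSmoothEmbedding (𝓡 (n + 1)) 𝓘(ℝ, E') ∞ e ∧
      e '' sphere 0 1 = j '' {x | ‖(x : 𝔼 (n + 1))‖ = 1} ∧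
      e '' closedBall 0 1 = range j ∧
      e '' ball 0 1 = j '' {x | ‖(x : 𝔼 (n + 1))‖ < 1} := by
  haveI : CompleteSpace E' := FiniteDimensional.complete ℝ E'
  -- Step A: Seeley extension
  obtain ⟨G, hG, hGj⟩ := exists_contDiff_extension_of_contMDiff_closedBall j hj.contMDiff
  have hGj' : (fun y : 𝔻 (n + 1) => G y) = j := funext hGj
  have himm : Manifold.IsImmersion (𝓡∂ (n + 1)) 𝓘(ℝ, E') ∞ fun y : 𝔻 (n + 1) => G y := by
    rw [hGj']; exact hj.isImmersion
  have hGc : Continuous G := hG.continuous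
  have hGd : Differentiable ℝ G := hG.differentiable (by simp)
  -- Step B: the open set where `DG` is invertible contains the disc
  set U₀ : Set (𝔼 (n + 1)) := (fderiv ℝ G) ⁻¹'
    range ((↑) : (𝔼 (n + 1) ≃L[ℝ] E') → 𝔼 (n + 1) →L[ℝ] E') with hU₀
  have hU₀open : IsOpen U₀ :=
    (ContinuousLinearEquiv.isOpen (𝕜 := ℝ) (E := 𝔼 (n + 1)) (F := E')).preimage
      (hG.continuous_fderiv (by simp))
  have hDU₀ : closedBall (0 : 𝔼 (n + 1)) 1 ⊆ U₀ := fun y hy =>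
    exists_coe_eq_fderiv_of_isImmersion hdim hG himm ⟨y, hy⟩
  obtain ⟨ε₁, hε₁, hthick₁⟩ :=
    (isCompact_closedBall (0 : 𝔼 (n + 1)) 1).exists_thickening_subset_open hU₀open hDU₀
  rw [thickening_closedBall hε₁ zero_le_one] at hthick₁
  -- Step C: local injectivity on `U₀` (inverse function theorem)
  have hloc : ∀ y ∈ U₀, ∃ U ∈ 𝓝 y, InjOn G U := by
    rintro y ⟨L, hL⟩
    have hy : HasFDerivAt G (L : 𝔼 (n + 1) →L[ℝ] E') y := by rw [hL]; exact (hGd y).hasFDerivAt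
    set Φ := hG.contDiffAt.toOpenPartialHomeomorph G hy (by simp) with hΦ
    refine ⟨Φ.source, Φ.open_source.mem_nhds (hG.contDiffAt.mem_toOpenPartialHomeomorph_source hy
      (by simp)), ?_⟩
    have : (Φ : 𝔼 (n + 1) → E') = G := hG.contDiffAt.toOpenPartialHomeomorph_coe hy (by simp)
    rw [← this]
    exact Φ.injOn
  -- Step D: injectivity on a ball `B(0, 1 + δ)`
  have hinjD : InjOn G (closedBall (0 : 𝔼 (n + 1)) 1) := by
    intro y₁ h₁ y₂ h₂ h
    have := hj.isEmbedding.injective (a₁ := ⟨y₁, h₁⟩) (a₂ := ⟨y₂, h₂⟩)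
      (by rw [← hGj, ← hGj]; exact h)
    exact congrArg Subtype.val this
  obtain ⟨δ, hδ, hinjδ⟩ := exists_injOn_thickening (isCompact_closedBall (0 : 𝔼 (n + 1)) 1) hGc
    hinjD fun y hy => hloc y (hDU₀ hy)
  rw [thickening_closedBall hδ zero_le_one] at hinjδ
  -- Step E: the radius `R` and the ball where `G` is an injective local diffeomorphism
  set R : ℝ := 1 + min ε₁ δ with hRdef
  have hR1 : 1 < R := by rw [hRdef]; linarith [lt_min hε₁ hδ]
  have hR : 0 < R := by linarith
  have hballU : ball (0 : 𝔼 (n + 1)) R ⊆ U₀ := fun y hy => hthick₁ (by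
    rw [mem_ball_zero_iff] at hy ⊢
    have := min_le_left ε₁ δ; rw [hRdef] at hy; linarith)
  have hballinj : InjOn G (ball (0 : 𝔼 (n + 1)) R) := fun y₁ h₁ y₂ h₂ h => hinjδ
    (by rw [mem_ball_zero_iff] at h₁ ⊢; have := min_le_right ε₁ δ; rw [hRdef] at h₁; linarith)
    (by rw [mem_ball_zero_iff] at h₂ ⊢; have := min_le_right ε₁ δ; rw [hRdef] at h₂; linarith) h
  have hGloc : ∀ y ∈ ball (0 : 𝔼 (n + 1)) R,
      IsLocalDiffeomorphAt 𝓘(ℝ, 𝔼 (n + 1)) 𝓘(ℝ, E') ∞ G y := by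
    intro y hy
    obtain ⟨L, hL⟩ := hballU hy
    refine isLocalDiffeomorphAt_of_hasFDerivAt_writtenInExtChartAt isOpen_ball hy
      hG.contMDiff.contMDiffOn (by simp) L ?_
    simp only [writtenInExtChartAt_model_space, extChartAt_model_space_eq_id, PartialEquiv.refl_coe,
      id_eq]
    rw [hL]; exact (hGd y).hasFDerivAt
  -- Step F: the rescaling radius `s` with `R s / √(1 + s²) = 1`
  have ha : 0 < R ^ 2 - 1 := by nlinarith
  set s : ℝ := 1 / Real.sqrt (R ^ 2 - 1) with hsdef
  have hs : 0 < s := by rw [hsdef]; positivity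
  have hkey : R * (s / Real.sqrt (1 + s ^ 2)) = 1 := by
    have h1s : 1 + s ^ 2 = R ^ 2 / (R ^ 2 - 1) := by
      rw [hsdef, div_pow, Real.sq_sqrt ha.le]
      field_simp
      ring
    have hsq : Real.sqrt (1 + s ^ 2) = R / Real.sqrt (R ^ 2 - 1) := by
      rw [h1s, Real.sqrt_div (sq_nonneg R), Real.sqrt_sq hR.le]
    rw [hsq, hsdef]
    have hsr : Real.sqrt (R ^ 2 - 1) ≠ 0 := (Real.sqrt_pos.2 ha).ne'
    field_simp
  -- Step G: the embedding
  set σs : 𝔼 (n + 1) ≃L[ℝ] 𝔼 (n + 1) :=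
    (LinearEquiv.smulOfNeZero ℝ (𝔼 (n + 1)) s hs.ne').toContinuousLinearEquiv with hσs
  have hσs_apply : ∀ x, σs x = s • x := fun x => rfl
  set e : 𝔼 (n + 1) → E' := G ∘ squeeze R ∘ σs with hedef
  have hld : IsLocalDiffeomorph 𝓘(ℝ, 𝔼 (n + 1)) 𝓘(ℝ, E') ∞ e := by
    intro x
    have h1 : IsLocalDiffeomorphAt 𝓘(ℝ, 𝔼 (n + 1)) 𝓘(ℝ, 𝔼 (n + 1)) ∞ σs x :=
      σs.toDiffeomorph.isLocalDiffeomorph x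
    have h2 : IsLocalDiffeomorphAt 𝓘(ℝ, 𝔼 (n + 1)) 𝓘(ℝ, 𝔼 (n + 1)) ∞ (squeeze R) (σs x) :=
      isLocalDiffeomorph_squeeze hR _
    have h3 := hGloc (squeeze R (σs x)) (by rw [← range_squeeze hR]; exact mem_range_self _)
    exact (h1.comp (K := 𝓘(ℝ, 𝔼 (n + 1))) (P := 𝔼 (n + 1)) h2).comp (K := 𝓘(ℝ, E')) (P := E') h3
  have hinj : Injective e := by
    intro x y hxy
    have h' := hballinj (by rw [← range_squeeze hR]; exact mem_range_self _)
      (by rw [← range_squeeze hR]; exact mem_range_self _) hxy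
    exact σs.injective (injective_squeeze R h')
  have hemb : Manifold.IsSmoothEmbedding (𝓡 (n + 1)) 𝓘(ℝ, E') ∞ e :=
    isSmoothEmbedding_of_isLocalDiffeomorph hld hinj
      (ContinuousLinearEquiv.ofFinrankEq (by rw [hdim, finrank_euclideanSpace_fin]))
  -- images
  have himσ : ∀ A : Set (𝔼 (n + 1)), σs '' A = s • A := fun A => by
    ext y; simp [hσs_apply, Set.mem_smul_set]
  have hsphere : (squeeze R ∘ σs) '' sphere (0 : 𝔼 (n + 1)) 1 = sphere 0 1 := by
    rw [image_comp, himσ, smul_sphere' hs.ne', smul_zero, Real.norm_eq_abs, abs_of_pos hs,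
      mul_one, image_squeeze_sphere hR hs.le, hkey]
  have hclosed : (squeeze R ∘ σs) '' closedBall (0 : 𝔼 (n + 1)) 1 = closedBall 0 1 := by
    rw [image_comp, himσ, smul_closedBall' hs.ne', smul_zero, Real.norm_eq_abs, abs_of_pos hs,
      mul_one, image_squeeze_closedBall hR hs.le, hkey]
  have hball : (squeeze R ∘ σs) '' ball (0 : 𝔼 (n + 1)) 1 = ball 0 1 := by
    -- `ball = closedBall ∖ sphere`, and the composite is injective
    have hinj' : Injective (squeeze R ∘ σs) := (injective_squeeze R).comp σs.injective
    rw [← closedBall_sdiff_sphere, image_sdiff hinj', hclosed, hsphere, closedBall_sdiff_sphere]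
  refine ⟨e, hemb, ?_, ?_, ?_⟩
  · rw [hedef, image_comp, hsphere]
    ext z
    constructor
    · rintro ⟨y, hy, rfl⟩
      exact ⟨⟨y, sphere_subset_closedBall hy⟩, mem_sphere_zero_iff_norm.1 hy, (hGj _).symm⟩
    · rintro ⟨x, hx, rfl⟩
      exact ⟨x, mem_sphere_zero_iff_norm.2 hx, hGj x⟩
  · rw [hedef, image_comp, hclosed]
    ext z
    constructor
    · rintro ⟨y, hy, rfl⟩; exact ⟨⟨y, hy⟩, (hGj _).symm⟩
    · rintro ⟨x, rfl⟩; exact ⟨x, x.2, hGj x⟩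
  · rw [hedef, image_comp, hball]
    ext z
    constructor
    · rintro ⟨y, hy, rfl⟩
      exact ⟨⟨y, ball_subset_closedBall hy⟩, mem_ball_zero_iff.1 hy, (hGj _).symm⟩
    · rintro ⟨x, hx, rfl⟩
      exact ⟨x, mem_ball_zero_iff.2 hx, hGj x⟩

end Extension

end ClosedDiscExtension

/-! ### §4 A closed side which is a smooth ball is a smoothly embedded ball -/

namespace SphereHypersurfaceSides.IsSidePackage

open ClosedDiscExtension

variable {m : ℕ} {Z : Set (𝕊 (m + 1))} {g : 𝕊 (m + 1) → ℝ}

/-- **The ball diffeomorphism matches the boundary sphere with `Z`**: for a ball diffeomorphism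
`Ψ : W ≅ 𝔻ᵐ⁺¹` of the closed side `W = {g ≤ 0}`, `ι_W (Ψ⁻¹ (∂𝔻ᵐ⁺¹)) = ∂W = Z` (invariance of
the boundary, through `BoundaryData.restrictDiffeomorph`). [folklore] -/
theorem image_incl_symm_norm_eq_one (hg : IsSidePackage Z g)
    (Ψ : RegularSublevel hg.isRegularLevel ≃ₘ⟮𝓡∂ (m + 1), 𝓡∂ (m + 1)⟯ 𝔻 (m + 1)) :
    (RegularSublevel.incl hg.isRegularLevel ∘ Ψ.symm) '' {x | ‖(x : 𝔼 (m + 1))‖ = 1} = Z := by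
  ext y
  constructor
  · rintro ⟨x, hx, rfl⟩
    have hx' : (x : 𝔼 (m + 1)) ∈ sphere (0 : 𝔼 (m + 1)) 1 := mem_sphere_zero_iff_norm.2 hx
    have key := BoundaryData.incl_restrictDiffeomorph (b₁ := closedBallBoundaryData m)
      (b₂ := RegularSublevel.boundaryData hg.isRegularLevel) Ψ.symm ⟨x, hx'⟩
    rw [RegularSublevel.boundaryData_incl, closedBallBoundaryData_incl] at key
    have hxe : Set.inclusion sphere_subset_closedBall (⟨(x : 𝔼 (m + 1)), hx'⟩ : 𝕊 m) = x :=
      Subtype.ext rfl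
    rw [hxe] at key
    show RegularSublevel.incl hg.isRegularLevel (Ψ.symm x) ∈ Z
    rw [← key]
    have hmem : RegularSublevel.incl hg.isRegularLevel
        ((closedBallBoundaryData m).restrictDiffeomorph
          (RegularSublevel.boundaryData hg.isRegularLevel) Ψ.symm ⟨x, hx'⟩).1 ∈ g ⁻¹' {0} :=
      (RegularSublevel.mem_boundary_iff hg.isRegularLevel _).1
        ((closedBallBoundaryData m).restrictDiffeomorph
          (RegularSublevel.boundaryData hg.isRegularLevel) Ψ.symm ⟨x, hx'⟩).2
    rwa [hg.preimage_zero] at hmem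
  · intro hy
    have hy0 : g y = 0 := by
      have : y ∈ g ⁻¹' {0} := hg.preimage_zero.symm ▸ hy
      exact this
    have hbd : RegularSublevel.mk hg.isRegularLevel y hy0.le ∈
        (𝓡∂ (m + 1)).boundary (RegularSublevel hg.isRegularLevel) :=
      (RegularSublevel.mem_boundary_iff hg.isRegularLevel _).2 hy0
    set z : 𝕊 m := (RegularSublevel.boundaryData hg.isRegularLevel).restrictDiffeomorph
      (closedBallBoundaryData m) Ψ ⟨_, hbd⟩ with hz
    have key := BoundaryData.incl_restrictDiffeomorph
      (b₁ := RegularSublevel.boundaryData hg.isRegularLevel) (b₂ := closedBallBoundaryData m) Ψ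
      ⟨_, hbd⟩
    rw [RegularSublevel.boundaryData_incl, closedBallBoundaryData_incl, ← hz] at key
    refine ⟨Set.inclusion sphere_subset_closedBall z, by simp [norm_eq_of_mem_sphere z], ?_⟩
    show RegularSublevel.incl hg.isRegularLevel (Ψ.symm (Set.inclusion sphere_subset_closedBall z)) = y
    change Set.inclusion sphere_subset_closedBall z = Ψ (RegularSublevel.mk hg.isRegularLevel y hy0.le)
      at key
    rw [key, Diffeomorph.symm_apply_apply, RegularSublevel.incl_mk]

/-- **A closed side which is a smooth ball is a smoothly embedded ball.** If the closed side
`W = {g ≤ 0}` of `Z = g⁻¹(0) ⊆ 𝕊 (m+1)` is diffeomorphic, as a manifold with boundary, to the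
closed disc `𝔻ᵐ⁺¹`, then for every point `p` of the other open side `{g > 0}` there is a smooth
embedding `e : ℝᵐ⁺¹ → 𝕊 (m+1)` with `e(𝕊ᵐ) = Z`, `e(𝔻ᵐ⁺¹) = W`, missing `p` — exactly the
shape of the named fact `SphereEmbedding.schoenflies_exists_ball` (`SchoenfliesSphereThree.lean`).
Proof: read `ι_W ∘ Ψ⁻¹ : 𝔻ᵐ⁺¹ → 𝕊 (m+1) ∖ {p}` in the stereographic chart from `p`, extend
(`exists_isSmoothEmbedding_extension`) and come back by `σₚ⁻¹`. [folklore] -/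
theorem exists_ball_of_diffeomorph_regularSublevel (hg : IsSidePackage Z g)
    (Ψ : RegularSublevel hg.isRegularLevel ≃ₘ⟮𝓡∂ (m + 1), 𝓡∂ (m + 1)⟯ 𝔻 (m + 1))
    {p : 𝕊 (m + 1)} (hp : 0 < g p) :
    ∃ e : 𝔼 (m + 1) → 𝕊 (m + 1), Manifold.IsSmoothEmbedding (𝓡 (m + 1)) (𝓡 (m + 1)) ∞ e ∧
      e '' sphere 0 1 = Z ∧ e '' closedBall 0 1 = {z | g z ≤ 0} ∧ p ∉ range e := by
  haveI : Fact (finrank ℝ (𝔼 (m + 1 + 1)) = m + 1 + 1) := ⟨finrank_euclideanSpace_fin⟩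
  haveI : CompactSpace (𝔻 (m + 1)) := isCompact_iff_compactSpace.1 (isCompact_closedBall _ _)
  set h0 := hg.isRegularLevel with hh0
  -- the closed side, embedded, and read in the stereographic chart from `p`
  set j₀ : (𝔻 (m + 1)) → 𝕊 (m + 1) := RegularSublevel.incl h0 ∘ Ψ.symm with hj₀def
  have hj₀ : Manifold.IsSmoothEmbedding (𝓡∂ (m + 1)) (𝓡 (m + 1)) ∞ j₀ :=
    (RegularSublevel.isSmoothEmbedding_incl h0).comp_diffeomorph Ψ.symm
  have hrange₀ : range j₀ = {z | g z ≤ 0} := by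
    have hs : Surjective (⇑Ψ.symm) := Ψ.symm.surjective
    rw [hj₀def, hs.range_comp, RegularSublevel.range_incl]; rfl
  set σ : OpenPartialHomeomorph (𝕊 (m + 1)) (𝔼 (m + 1)) := stereographic' (m + 1) p with hσ
  have hsrc : σ.source = {p}ᶜ := stereographic'_source p
  have htgt : σ.target = univ := stereographic'_target p
  have hatlas : σ ∈ IsManifold.maximalAtlas (𝓡 (m + 1)) ∞ (𝕊 (m + 1)) :=
    IsManifold.subset_maximalAtlas (stereographic'_mem_atlas p)
  have hσs : ContMDiffOn (𝓡 (m + 1)) (𝓡 (m + 1)) ∞ σ σ.source :=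
    contMDiffOn_of_mem_maximalAtlas hatlas
  have hσs' : ContMDiffOn (𝓡 (m + 1)) (𝓡 (m + 1)) ∞ σ.symm σ.target :=
    contMDiffOn_symm_of_mem_maximalAtlas hatlas
  have hj₀src : ∀ x, j₀ x ∈ σ.source := fun x => by
    rw [hsrc, mem_compl_singleton_iff]
    intro hx
    have hle : g (j₀ x) ≤ 0 := by
      have : j₀ x ∈ range j₀ := mem_range_self x
      rw [hrange₀] at this; exact this
    rw [hx] at hle
    linarith
  -- `j = σ ∘ j₀` is a smooth embedding of the disc into `ℝᵐ⁺¹`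
  set j : (𝔻 (m + 1)) → 𝔼 (m + 1) := σ ∘ j₀ with hj
  have hjemb : Manifold.IsSmoothEmbedding (𝓡∂ (m + 1)) 𝓘(ℝ, 𝔼 (m + 1)) ∞ j := by
    refine ⟨hj₀.isImmersion.openPartialHomeomorph_comp σ hσs hσs' hj₀src, ?_⟩
    have hc : Continuous j := σ.continuousOn.comp_continuous hj₀.contMDiff.continuous hj₀src
    have hi : Injective j := fun x y hxy =>
      hj₀.isEmbedding.injective (σ.injOn (hj₀src x) (hj₀src y) hxy)
    exact (hc.isClosedEmbedding hi).isEmbedding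
  obtain ⟨e₀, he₀, hsph, hcl, -⟩ := exists_isSmoothEmbedding_extension (n := m)
    (E' := 𝔼 (m + 1)) finrank_euclideanSpace_fin hjemb
  have hsymm_src : ∀ y, e₀ y ∈ σ.symm.source := fun y => by
    rw [σ.symm_source, htgt]; exact mem_univ _
  refine ⟨σ.symm ∘ e₀, ⟨?_, ?_⟩, ?_, ?_, ?_⟩
  · refine he₀.isImmersion.openPartialHomeomorph_comp σ.symm ?_ ?_ hsymm_src
    · rw [σ.symm_source]; exact hσs'
    · rw [σ.symm_symm, σ.symm_target]; exact hσs
  · exact (isSmoothEmbedding_stereographic'_symm p).isEmbedding.comp he₀.isEmbedding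
  · rw [image_comp, hsph, hj, image_comp]
    have h1 : σ.symm '' (σ '' (j₀ '' {x : 𝔻 (m + 1) | ‖(x : 𝔼 (m + 1))‖ = 1})) =
        j₀ '' {x : 𝔻 (m + 1) | ‖(x : 𝔼 (m + 1))‖ = 1} :=
      σ.symm_image_image_of_subset_source (by rintro _ ⟨x, -, rfl⟩; exact hj₀src x)
    rw [h1, hj₀def]
    exact hg.image_incl_symm_norm_eq_one Ψ
  · rw [image_comp, hcl, hj, range_comp]
    have h1 : σ.symm '' (σ '' range j₀) = range j₀ :=
      σ.symm_image_image_of_subset_source (by rintro _ ⟨x, rfl⟩; exact hj₀src x)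
    rw [h1, hrange₀]
  · rintro ⟨y, hy⟩
    have hmem : σ.symm (e₀ y) ∈ σ.source := σ.map_target (by rw [htgt]; exact mem_univ _)
    rw [hsrc, mem_compl_singleton_iff] at hmem
    exact hmem hy

/-- **One-sided form with a sphere embedding**: if the closed side `{g ≤ 0}` of a side package
for `range S`, `S : SphereEmbedding m (m+1)`, is a smooth ball, then `S` bounds a smoothly
embedded ball missing any prescribed point of `{g > 0}`. [folklore] -/
theorem _root_.Literature.Topology.FourManifolds.SphereEmbedding.exists_ball_of_diffeomorph_regularSublevel
    {S : SphereEmbedding m (m + 1)} {g : 𝕊 (m + 1) → ℝ} (hg : IsSidePackage (range S) g)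
    (Ψ : RegularSublevel hg.isRegularLevel ≃ₘ⟮𝓡∂ (m + 1), 𝓡∂ (m + 1)⟯ 𝔻 (m + 1))
    {p : 𝕊 (m + 1)} (hp : 0 < g p) :
    ∃ e : 𝔼 (m + 1) → 𝕊 (m + 1), Manifold.IsSmoothEmbedding (𝓡 (m + 1)) (𝓡 (m + 1)) ∞ e ∧
      e '' sphere 0 1 = range S ∧ p ∉ e '' closedBall 0 1 := by
  obtain ⟨e, he, hsph, hcl, -⟩ := hg.exists_ball_of_diffeomorph_regularSublevel Ψ hp
  refine ⟨e, he, hsph, ?_⟩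
  rw [hcl]
  exact fun h => absurd h (not_le.2 hp)

end SphereHypersurfaceSides.IsSidePackage

/-! ### §5 The residual content of Alexander's theorem -/

/-- **The Schoenflies theorem in `S³` follows from: every closed side of every smoothly embedded
`2`-sphere in `S³` is a smooth `3`-ball.**  Precisely, if for every `S : SphereEmbedding 2 3`
and every side package `g` of `range S` (`SphereHypersurfaceSides.lean`) the compact smooth
`3`-manifold with boundary `W = {g ≤ 0}` is diffeomorphic to `𝔻³`, then the named fact
`SphereEmbedding.schoenflies_exists_ball` (`SchoenfliesSphereThree.lean`; Schultens 2014,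
Thm. 3.2.5 with Cor. 3.2.6) holds.  This isolates the remaining content of Alexander's theorem
as an intrinsic statement about the region bounded by the sphere. [cite: Schultens2014, Thm. 3.2.5 and Cor. 3.2.6 (PDF pp. 43, 45)] -/
theorem SphereEmbedding.schoenflies_exists_ball_of_sides_diffeomorph_closedBall
    (H : ∀ (S : SphereEmbedding 2 3) (g : 𝕊 3 → ℝ)
      (hg : SphereHypersurfaceSides.IsSidePackage (m := 2) (range S) g),
      Nonempty (RegularSublevel hg.isRegularLevel ≃ₘ⟮𝓡∂ (2 + 1), 𝓡∂ (2 + 1)⟯ 𝔻 (2 + 1))) :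
    SphereEmbedding.schoenflies_exists_ball := by
  intro S p hp
  obtain ⟨g, hg, hgp⟩ := S.exists_isSidePackage_neg (by norm_num) hp
  -- use the side package `-g`, for which `p` lies in `{-g > 0}`
  obtain ⟨Ψ⟩ := H S (fun z => -g z) hg.neg
  exact SphereEmbedding.exists_ball_of_diffeomorph_regularSublevel hg.neg Ψ (by simpa using hgp)

end Literature.Topology.FourManifolds

end
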